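import Literature.NumberTheory.Transcendental.LWMeasureSmallnessComposite
import Literature.NumberTheory.Transcendental.LWMeasureSmallTermsEpsArith
import HarnessLib

/-!
# The Lindemann–Weierstrass measure (Ably 1994, §II) — the `ε`-terms of (6)/(8) under the final parameters

`Literature/NumberTheory/Transcendental/LWMeasureSmallTermsEps.lean` — proofs only (no
definitions, no named facts, nothing asserted). A step of the choice of parameters in the
"Proposition principale" of M. Ably, *Une version quantitative du théorème de
Lindemann–Weierstrass*, Acta Arith. 67 (1994) 29–45, §II (4)–(8), pp. 38–41, behind the named
fact `Ably1994_lindemannWeierstrass_measure`: in the closed form (6) of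
`LWMeasure.Setup.norm_aeval_Qj_le_composite` (`LWMeasureSmallnessComposite.lean`) taken at
`ε = e^{-2R}`, `R_c = L`, the three terms carrying a factor `ε` — the coefficient term
`LD · 2^{n(b-1)} bⁿ H n(b-1) A^{n(b-1)} ε · (L+D)^s K₁(M)^L A^{degM}` and the two Hermite terms
`|c|^L s! 𝓗(ρ+1)`, `|c|^L s! 𝓗(L) ((2ρ+1)/(L-ρ))^{T'Mⁿ}` — are together `≤ e^{-R}/2` once
`M ≥ M₀(S, c_{ST}, k_S, c_S)` under the final relations between `L, D, b, M, T', s, δ, H, R`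
(`LWMeasure.Setup.small_terms_eps`): Ably's data (`K₁(M) ≤ K₁(1) M`, `ρ ≤ (1 + ∑|y_k|) M`,
`degM ≤ (d + 2^{n+4} d n) M`, `Λ₀ = (δ ω^M)^{M^{n-1}}` with `ω = min(1, |y_n|/2)`) fed to the
abstract bookkeeping `LWMeasure.small_terms_eps_aux` (`LWMeasureSmallTermsEpsArith.lean`).

## References

* [Ably1994] M. Ably, *Une version quantitative du théorème de Lindemann–Weierstrass*, Acta Arith.
  67 (1994) 29–45, §II 2e pas, (4)–(8) pp. 38–41.
-/

noncomputable section

open scoped Nat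
open MvPolynomial Finset Complex

namespace Literature.NumberTheory.Transcendental

namespace LWMeasure

namespace Setup

/-- **The `ε`-terms of (6)/(8) under the final parameters** (Ably 1994, §II, pp. 39–41). In the
closed form (6) of `norm_aeval_Qj_le_composite` at `ε = e^{-2R}`, `R_c = L`, the coefficient term
and the two Hermite terms `|c|^L s! 𝓗(ρ+1)`, `|c|^L s! 𝓗(L) ((2ρ+1)/(L-ρ))^{T'Mⁿ}` are together
`≤ e^{-R}/2` once `M ≥ M₀(S, c_{ST}, k_S, c_S)`, under the final relations `Mⁿ ≤ L`,
`D ≤ 2^{n+4} d`, `b ≤ DM`, `T'Mⁿ ≤ 8L`, `sMⁿ ≤ c_{ST} L`, `Mⁿ L log M ≤ R ≤ (5/4) L log L ≤ 5R`,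
`H ≤ LDbⁿ(L+D)^{T'}K₁(M)^L`, `c_S/(nM)^{k_S} ≤ δ ≤ 1` (the remaining maximum-modulus term
`|c|^L s! B ((2ρ+1)/(L-ρ))^{T'Mⁿ}` of (6) is bounded separately).
[cite: Ably1994, §II (6)–(8) pp. 39–41] -/
theorem small_terms_eps (S : Setup) (cST kS : ℕ) {cS : ℝ} (hcS : 0 < cS) (hcS1 : cS ≤ 1) :
    ∃ M₀ : ℕ, ∀ (L D b M T' s : ℕ) (δ H R : ℝ),
      M₀ ≤ M → M ^ S.n ≤ L → 1 ≤ D → D ≤ 2 ^ (S.n + 4) * S.d → 1 ≤ b → b ≤ D * M →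
      T' * M ^ S.n ≤ 8 * L → 7 * L ≤ T' * M ^ S.n → s * M ^ S.n ≤ cST * L →
      (M : ℝ) ^ S.n * L * Real.log M ≤ R → R ≤ 5 / 4 * L * Real.log L → L * Real.log L ≤ 4 * R →
      0 ≤ H → H ≤ ((L * D * b ^ S.n : ℕ) : ℝ) * (((L : ℝ) + D) ^ T' * S.K₁ M ^ L) →
      0 < δ → δ ≤ 1 → cS / ((S.n : ℝ) * M) ^ kS ≤ δ →
      (L : ℝ) * D * ((2 ^ (S.n * (b - 1)) * ((b : ℝ) ^ S.n * H) * ((S.n * (b - 1) : ℕ) : ℝ) *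
          S.A ^ (S.n * (b - 1)) * Real.exp (-(2 * R))) * (((L : ℝ) + D) ^ s * S.K₁ M ^ L * S.A ^ S.degM D M)) +
      |(S.c : ℝ)| ^ L * ((s.factorial : ℝ) *
          (((M ^ S.n : ℕ) : ℝ) * T' *
            ((L : ℝ) * D * ((2 ^ (S.n * (b - 1)) * ((b : ℝ) ^ S.n * H) * S.A ^ (S.n * (b - 1))) *
              (((L : ℝ) + D) ^ T' * S.K₁ M ^ L * (S.degM D M : ℝ) * S.A ^ S.degM D M * Real.exp (-(2 * R))))) *
            (2 * (ptsRad S.y M + 1 + ptsRad S.y M)) ^ (T' * M ^ S.n) * (2 / δ) ^ T' /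
              ptsProd S.y M δ ^ T')) +
      |(S.c : ℝ)| ^ L * ((s.factorial : ℝ) *
          ((((M ^ S.n : ℕ) : ℝ) * T' *
              ((L : ℝ) * D * ((2 ^ (S.n * (b - 1)) * ((b : ℝ) ^ S.n * H) * S.A ^ (S.n * (b - 1))) *
              (((L : ℝ) + D) ^ T' * S.K₁ M ^ L * (S.degM D M : ℝ) * S.A ^ S.degM D M * Real.exp (-(2 * R))))) *
              (2 * ((L : ℝ) + ptsRad S.y M)) ^ (T' * M ^ S.n) * (2 / δ) ^ T' / ptsProd S.y M δ ^ T') *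
            ((ptsRad S.y M + 1 + ptsRad S.y M) / ((L : ℝ) - ptsRad S.y M)) ^ (T' * M ^ S.n))) ≤
        Real.exp (-R) / 2 := by
  have hcρ : (1 : ℝ) ≤ 1 + ∑ k, ‖S.y k‖ :=
    le_add_of_nonneg_right (Finset.sum_nonneg fun k _ => norm_nonneg _)
  have hcdeg : (0 : ℝ) ≤ (S.d : ℝ) + 2 ^ (S.n + 4) * (S.d : ℝ) * S.n := by positivity
  obtain ⟨M₀, hM₀⟩ := small_terms_eps_aux S.n S.d cST kS S.one_le_n hcS hcS1 S.one_le_abs_c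
    S.one_le_A (S.one_le_K₁ 1) hcρ hcdeg S.lastNorm_y_pos (min_le_left _ _)
  refine ⟨M₀ + 1, ?_⟩
  intro L D b M T' s δ H R hM hL _hD hDd _hb hbDM hT' _h7 hs hR1 hR2 hR3 hH0 hH hδ _hδ1 hδ'
  have hM1 : 1 ≤ M := by omega
  have hM1r : (1 : ℝ) ≤ M := by exact_mod_cast hM1
  -- `K₁(M) ≤ K₁(1) M`
  have hK1le : S.K₁ M ≤ S.K₁ 1 * M := by
    have hP : 0 ≤ |(S.c : ℝ)| * (1 + Chudnovsky.zl1 S.μ) ^ S.dR :=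
      mul_nonneg (abs_nonneg _) (pow_nonneg (add_nonneg zero_le_one (apply_nonneg _ _)) _)
    have hAR := S.AR_nonneg
    have h1 : (1 : ℝ) + M * S.AR ≤ (1 + 1 * S.AR) * M := by nlinarith
    have h2 := mul_le_mul_of_nonneg_left h1 hP
    unfold K₁
    push_cast
    linarith
  -- `ρ ≤ (1 + ∑|y_k|) M`
  have hρle : ptsRad S.y M ≤ (1 + ∑ k, ‖S.y k‖) * M := by
    rw [mul_comm]; exact S.ptsRad_le hM1
  -- `degM ≤ (d + 2^{n+4} d n) M`
  have hdM : (S.degM D M : ℝ) ≤ ((S.d : ℝ) + 2 ^ (S.n + 4) * (S.d : ℝ) * S.n) * M := by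
    have h1 : S.degM D M ≤ S.d * M + 2 ^ (S.n + 4) * S.d * S.n * M := by
      unfold degM
      calc S.d - 1 + (D - 1) * (S.n * (M - 1)) ≤ S.d * M + D * (S.n * M) :=
            add_le_add ((Nat.sub_le _ _).trans (Nat.le_mul_of_pos_right _ hM1))
              (Nat.mul_le_mul (Nat.sub_le _ _) (Nat.mul_le_mul_left _ (Nat.sub_le _ _)))
        _ ≤ S.d * M + 2 ^ (S.n + 4) * S.d * (S.n * M) := by gcongr
        _ = S.d * M + 2 ^ (S.n + 4) * S.d * S.n * M := by ring
    have h2 : ((S.degM D M : ℕ) : ℝ) ≤ ((S.d * M + 2 ^ (S.n + 4) * S.d * S.n * M : ℕ) : ℝ) := by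
      exact_mod_cast h1
    push_cast at h2
    linarith
  unfold ptsProd
  exact hM₀ L D b M T' s (S.degM D M) δ H R (S.K₁ M) (ptsRad S.y M) (S.one_le_K₁ M) hK1le
    (one_le_ptsRad S.y M) hρle hdM (by omega) hL hDd hbDM hT' hs hR1 hR2 hR3 hH0 hH hδ hδ'

end Setup

end LWMeasure

end Literature.NumberTheory.Transcendental

end
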